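import Literature.AlgebraicGeometry.ShimuraVarieties.UnitaryCurveConeModulus
import Literature.NumberTheory.Automorphic.UnitaryCurveCohCotangentFormsContinuous
import Literature.Analysis.Complex.MontelSCV
import HarnessLib

/-!
# Right-`K`-invariant cone-holomorphic cotangent forms (rank 2): representatives, EQUICONTINUITY of the sup-unit-ball, and CLOSEDNESS
# under pointwise limits (Montel on the cone-open) — the compactness inputs of the finite-dimensionality theorem

Topic `NumberTheory/Automorphic`; namespace `Literature.NumberTheory.Automorphic.UnitaryCurveForms` (the carriers' namespace of ★
`UnitaryCurveCohCotangentForms`).  THEOREMS ONLY (no `def`, no instance, no notation, no named fact, no `sorry`).  Sequel: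
`UnitaryCurveHolCotFormsLevelFinite` (Arzelà–Ascoli + Riesz ⇒ `holCotForms₂ 𝔣 ⊓ (rightRep₂)^K` finite-dimensional).

SETTING: the rank-2 unitary datum `(F, E, c, J, hc, hfix, w₁)` of ★ `UnitaryCurveCohCotangentForms` (`U(J)(𝔸_F) = (adelicGroupData F E c 2 J).Adelic`),
a cone frame `𝔣` with `σ_{w₁}J` hermitian, the carrier `holCotForms₂ … 𝔣` ((L) left `U(J)(F)`-invariant, (Kc) right-invariant under the archimedean
factor away from `w₁`, (Sm) smooth, (H) cone-holomorphic `w₁`-slices), an OPEN subgroup `K ≤ U(J)(𝔸_{F,f})`.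

* §1 `exists_isCompact_quotientSubgroup_mul` — a COMPACT SET OF REPRESENTATIVES `D` with `U(J)(𝔸_F) = (A_G·U(J)(F))·D` from
  `[LocallyCompactSpace U(J)(𝔸_F)]` + `[CompactSpace (automorphic quotient)]`; `norm_le_of_norm_le_on` — a left-invariant form is read on `D`.
* §2 `apply_eq_slice_of_mem` — near `x₀` a right-`K`-invariant form reads `f x = Φ((x_∞)_{w₁})` with `Φ` its cone-holomorphic slice at
  `(1, x₀,f)`; **`exists_nhds_norm_sub_lt`** — EQUICONTINUITY of all such `f` with `‖f‖_∞ ≤ 1`: their slices are bounded by `1` on `U(σ_{w₁}J)(ℂ)`,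
  hence locally uniformly bounded on the cone-open by the cotangent modulus (★ `UnitaryCurveCone.locallyBounded_family`), hence equi-Lipschitz by
  Cauchy's estimate (★ `Literature.Analysis.Complex.SCV.exists_ball_norm_sub_le_of_locally_bounded`).
* §3 **`exists_isConeHol_slice_of_tendsto`**, **`mem_of_tendsto`** — CLOSEDNESS: a pointwise limit of such forms bounded by `1` is again one; its
  slices are cone-holomorphic by MONTEL (★ `SCV.exists_strictMono_tendstoLocallyUniformlyOn`, ★ `SCV.differentiableOn_of_tendstoLocallyUniformlyOn`):
  the cone law and the values on the group pass to the limit, non-units get `0` (forced by the law at `a = 0`).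
[BorelJacquet1979, §4.2–§4.3]; [Borel1997, §5.14, §8]; [HormanderSCV1973, Thm. 2.2.7].  Cell `hodgecm-mathlib`, floor 0, K-lane of the P5 named fact
E₂ (cut S3₂, F0P5-p02 (g2) census `CENSUS-KE2-cohIsotypicLine2`); seat F0P5-p04 (g2).  HC_CM is proved only modulo the printed citations until rung 0
closes; nothing printed is asserted here.

## References
* [BorelJacquet1979] A. Borel, H. Jacquet, *Automorphic forms and automorphic representations*, PSPM 33.1 (1979), §4.1–§4.3.
* [Borel1997] A. Borel, *Automorphic forms on SL₂(ℝ)*, Cambridge Tracts in Math. 130 (1997), §5.14, §8.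
* [HormanderSCV1973] L. Hörmander, *An Introduction to Complex Analysis in Several Variables* (1973), Thm. 2.2.7.
-/

set_option autoImplicit false

noncomputable section

open NumberField NumberField.InfinitePlace Topology Matrix Filter Metric Set
open scoped Matrix MatrixGroups ComplexConjugate ComplexOrder Topology Pointwise BoundedContinuousFunction

namespace Literature.NumberTheory.Automorphic

namespace UnitaryCurveForms

open UnitaryGroup Literature.AlgebraicGeometry.ShimuraVarieties Literature.AlgebraicGeometry.ShimuraVarieties.UnitaryCurveCone

variable (F E : Type) [Field F] [NumberField F] [Field E] [NumberField E] [Algebra F E]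
  (c : E ≃ₐ[F] E) (J : Matrix (Fin 2) (Fin 2) E)
  (hc : c ≠ 1) (hfix : ∀ w : InfinitePlace E, c • w = w) (w₁ : {w : InfinitePlace E // IsComplex w})

/-! ## §1 A compact set of representatives for `U(J)(F)\U(J)(𝔸_F)` -/

/-- The quotient subgroup of the unitary datum is the image of the rational points (`U(J)` has trivial split centre):
`A_G · U(J)(F) = U(J)(F)`. [cite: BorelJacquet1979, §4.2] -/
theorem quotientSubgroup_eq_range :
    (adelicGroupData F E c 2 J).quotientSubgroup = (adelicGroupData F E c 2 J).toAdelic.range :=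
  bot_sup_eq _

/-- **A compact set of representatives**: if `U(J)(𝔸_F)` is locally compact and the automorphic quotient is compact, there is a COMPACT
`D ⊆ U(J)(𝔸_F)` with `U(J)(𝔸_F) = (A_G · U(J)(F)) · D`. [cite: BorelJacquet1979, §4.2] -/
theorem exists_isCompact_quotientSubgroup_mul [LocallyCompactSpace (adelicGroupData F E c 2 J).Adelic]
    [CompactSpace (adelicGroupData F E c 2 J).automorphicQuotient] :
    ∃ D : Set (adelicGroupData F E c 2 J).Adelic, IsCompact D ∧
      ∀ x : (adelicGroupData F E c 2 J).Adelic, ∃ γ ∈ (adelicGroupData F E c 2 J).quotientSubgroup, ∃ d ∈ D, x = γ * d := by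
  classical
  have hK : ∀ x : (adelicGroupData F E c 2 J).Adelic, ∃ K : Set (adelicGroupData F E c 2 J).Adelic, IsCompact K ∧ K ∈ 𝓝 x :=
    fun x => exists_compact_mem_nhds x
  choose K hKc hKn using hK
  -- the open cover of the compact quotient by the images of the interiors
  have hπo : IsOpenMap (adelicGroupData F E c 2 J).toAutomorphicQuotient := QuotientGroup.isOpenMap_coe
  have hVo : ∀ x, IsOpen ((adelicGroupData F E c 2 J).toAutomorphicQuotient '' interior (K x)) := fun x => hπo _ isOpen_interior
  have hcov : (univ : Set (adelicGroupData F E c 2 J).automorphicQuotient) ⊆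
      ⋃ x, (adelicGroupData F E c 2 J).toAutomorphicQuotient '' interior (K x) := by
    intro y _
    obtain ⟨x, rfl⟩ := QuotientGroup.mk_surjective y
    exact mem_iUnion.2 ⟨x, x, mem_interior_iff_mem_nhds.2 (hKn x), rfl⟩
  obtain ⟨t, ht⟩ := isCompact_univ.elim_finite_subcover _ hVo hcov
  refine ⟨(⋃ x ∈ t, K x)⁻¹, (t.isCompact_biUnion fun x _ => hKc x).inv, fun x => ?_⟩
  have hx : (adelicGroupData F E c 2 J).toAutomorphicQuotient x⁻¹ ∈
      ⋃ i ∈ t, (adelicGroupData F E c 2 J).toAutomorphicQuotient '' interior (K i) := ht (mem_univ _)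
  obtain ⟨i, hi, hxi⟩ := mem_iUnion₂.1 hx
  obtain ⟨d, hd, hdx⟩ := hxi
  -- `[d] = [x⁻¹]` ⇒ `d⁻¹ x⁻¹ ∈ A_G·U(J)(F)` ⇒ `x d ∈ A_G·U(J)(F)`
  have hγ : x * d ∈ (adelicGroupData F E c 2 J).quotientSubgroup := by
    have h : d⁻¹ * x⁻¹ ∈ (adelicGroupData F E c 2 J).quotientSubgroup := QuotientGroup.eq.1 hdx
    rw [← _root_.mul_inv_rev] at h
    exact (Subgroup.inv_mem_iff _).1 h
  refine ⟨x * d, hγ, d⁻¹, ?_, by group⟩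
  exact Set.inv_mem_inv.2 (mem_biUnion hi (interior_subset hd))

variable {F E c J hc hfix w₁}

/-- A left-`U(J)(F)`-form is determined by its values on a set of representatives: the sup bound transfers from `D` to the group.
[cite: BorelJacquet1979, §4.2] -/
theorem norm_le_of_norm_le_on {D : Set (adelicGroupData F E c 2 J).Adelic}
    (hD : ∀ x : (adelicGroupData F E c 2 J).Adelic, ∃ γ ∈ (adelicGroupData F E c 2 J).quotientSubgroup, ∃ d ∈ D, x = γ * d)
    {f : (adelicGroupData F E c 2 J).Adelic → ℂ}
    (hL : ∀ (γ : (adelicGroupData F E c 2 J).Rational) (x : (adelicGroupData F E c 2 J).Adelic),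
      f ((adelicGroupData F E c 2 J).toAdelic γ * x) = f x)
    (x : (adelicGroupData F E c 2 J).Adelic) : ∃ d ∈ D, f x = f d := by
  obtain ⟨γ, hγ, d, hd, rfl⟩ := hD x
  rw [quotientSubgroup_eq_range] at hγ
  obtain ⟨γ₀, rfl⟩ := hγ
  exact ⟨d, hd, hL γ₀ d⟩

/-! ## §2 Slices of bounded forms: the local model near a point and equicontinuity -/

/-- **The local model near `x₀`**: for `f ∈ holCotForms₂ 𝔣` right-invariant under an open `K` and `Φ` its (H)-slice at `(1, x₀,f)`, on the open
neighbourhood `{x | x₀,f⁻¹ x_f ∈ K}` of `x₀` one has `f x = Φ ((x_∞)_{w₁})`. [cite: BorelJacquet1979, §4.1–§4.2] -/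
theorem apply_eq_slice_of_mem (𝔣 : ConeFrame E J w₁) {K : Subgroup (finAdelic F E c 2 J)}
    {f : (adelicGroupData F E c 2 J).Adelic → ℂ} (hf : f ∈ holCotForms₂ F E c J hc hfix w₁ 𝔣)
    (hfK : ∀ k ∈ K, ∀ x : (adelicGroupData F E c 2 J).Adelic, f (x * finAdelicToAdelic F E c 2 J k) = f x)
    (x₀ : (adelicGroupData F E c 2 J).Adelic) {Φ : Matrix (Fin 2) (Fin 2) ℂ → ℂ}
    (hΦ : ∀ u : archLocal E 2 J w₁, Φ ((u : GL (Fin 2) ℂ) : Matrix (Fin 2) (Fin 2) ℂ) =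
      f (finAdelicToAdelic F E c 2 J (UnitaryGroup.finPart F E c 2 J x₀) * adelicSingle F E c 2 J hc hfix w₁ u))
    {x : (adelicGroupData F E c 2 J).Adelic} (hx : (UnitaryGroup.finPart F E c 2 J x₀)⁻¹ * UnitaryGroup.finPart F E c 2 J x ∈ K) :
    f x = Φ (((archAt F E c 2 J w₁ (hfix w₁.1) hc (UnitaryGroup.archPart F E c 2 J x) : archLocal E 2 J w₁) : GL (Fin 2) ℂ) :
      Matrix (Fin 2) (Fin 2) ℂ) := by
  rw [apply_eq_apply_finAdelicToAdelic_mul_adelicSingle F E c J hc hfix w₁ 𝔣 hf x, hΦ]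
  have hsplit : finAdelicToAdelic F E c 2 J (UnitaryGroup.finPart F E c 2 J x) =
      finAdelicToAdelic F E c 2 J (UnitaryGroup.finPart F E c 2 J x₀) * finAdelicToAdelic F E c 2 J ((UnitaryGroup.finPart F E c 2 J x₀)⁻¹ * UnitaryGroup.finPart F E c 2 J x) := by
    rw [← map_mul, mul_inv_cancel_left]
  rw [hsplit, mul_assoc, ← adelicSingle_mul_finAdelicToAdelic F E c 2 J hc hfix w₁, ← mul_assoc, hfK _ hx]

/-- **EQUICONTINUITY of the sup-unit-ball** of right-`K`-invariant holomorphic cotangent forms (`K` open): for every `x₀` and `ε > 0` there is a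
neighbourhood `N` of `x₀` with `‖f x − f x₀‖ < ε` on `N` for ALL such `f` with `‖f‖_∞ ≤ 1` — Cauchy's estimate for the locally uniformly bounded
family of their `w₁`-slices (★ `UnitaryCurveCone.exists_ball_norm_apply_le`, ★ `Literature.Analysis.Complex.SCV.exists_ball_norm_sub_le_of_locally_bounded`).
[cite: HormanderSCV1973, Thm 2.2.7] [cite: BorelJacquet1979, §4.2–§4.3] -/
theorem exists_nhds_norm_sub_lt (𝔣 : ConeFrame E J w₁) (hJ : (J.map w₁.1.embedding).IsHermitian) {K : Subgroup (finAdelic F E c 2 J)}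
    (hKo : IsOpen (K : Set (finAdelic F E c 2 J))) (x₀ : (adelicGroupData F E c 2 J).Adelic) {ε : ℝ} (hε : 0 < ε) :
    ∃ N ∈ 𝓝 x₀, ∀ f : (adelicGroupData F E c 2 J).Adelic → ℂ, f ∈ holCotForms₂ F E c J hc hfix w₁ 𝔣 →
      (∀ k ∈ K, ∀ x : (adelicGroupData F E c 2 J).Adelic, f (x * finAdelicToAdelic F E c 2 J k) = f x) →
      (∀ y, ‖f y‖ ≤ 1) → ∀ x ∈ N, ‖f x - f x₀‖ < ε := by
  -- the matrix of the `w₁`-component (read in `ℂ^{2×2}`), a continuous function of the adelic point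
  set mat : (adelicGroupData F E c 2 J).Adelic → (Fin 2 → Fin 2 → ℂ) := fun x i j =>
    (((archAt F E c 2 J w₁ (hfix w₁.1) hc (UnitaryGroup.archPart F E c 2 J x) : archLocal E 2 J w₁) : GL (Fin 2) ℂ) : Matrix (Fin 2) (Fin 2) ℂ) i j
    with hmat
  have hmatc : Continuous mat := by
    have h1 : Continuous fun u : archLocal E 2 J w₁ => (((u : GL (Fin 2) ℂ) : Matrix (Fin 2) (Fin 2) ℂ) : Fin 2 → Fin 2 → ℂ) :=
      Units.continuous_val.comp continuous_subtype_val
    exact h1.comp ((continuous_archAt F E c 2 J w₁ (hfix w₁.1) hc).comp (UnitaryGroup.continuous_archPart F E c 2 J))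
  -- the family of all cone-holomorphic functions bounded by `1` on the group: locally bounded on the cone-open, hence equi-Lipschitz
  set ι := {Φ : Matrix (Fin 2) (Fin 2) ℂ → ℂ // IsConeHol 𝔣 Φ ∧
    ∀ u : archLocal E 2 J w₁, ‖Φ ((u : GL (Fin 2) ℂ) : Matrix (Fin 2) (Fin 2) ℂ)‖ ≤ 1} with hι
  have hdiff := differentiableOn_family 𝔣 (fun i : ι => i.1) (fun i => i.2.1)
  have hbdd := locallyBounded_family 𝔣 hJ (fun i : ι => i.1) (fun i => i.2.1) (fun i => i.2.2)
  have hx₀Ω := coe_archLocal_mem_coneOpen 𝔣 (archAt F E c 2 J w₁ (hfix w₁.1) hc (UnitaryGroup.archPart F E c 2 J x₀))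
  obtain ⟨R, hR, L, -, hLip⟩ := Literature.Analysis.Complex.SCV.exists_ball_norm_sub_le_of_locally_bounded (isOpen_coneOpen 𝔣) hdiff hbdd hx₀Ω
  -- the neighbourhood: finite part in `x₀,f K`, `w₁`-matrix within `δ` of that of `x₀`
  set δ : ℝ := min R (ε / (|L| + 1)) with hδ
  have hδpos : 0 < δ := lt_min hR (div_pos hε (by positivity))
  set N : Set (adelicGroupData F E c 2 J).Adelic :=
    {x | (UnitaryGroup.finPart F E c 2 J x₀)⁻¹ * UnitaryGroup.finPart F E c 2 J x ∈ (K : Set (finAdelic F E c 2 J))} ∩ {x | dist (mat x) (mat x₀) < δ} with hN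
  have hNo : IsOpen N :=
    (hKo.preimage (continuous_const.mul (UnitaryGroup.continuous_finPart F E c 2 J))).inter
      (isOpen_lt (hmatc.dist continuous_const) continuous_const)
  have hx₀N : x₀ ∈ N := by
    refine ⟨?_, ?_⟩
    · simp only [mem_setOf_eq, inv_mul_cancel, SetLike.mem_coe]
      exact K.one_mem
    · simp only [mem_setOf_eq, dist_self]
      exact hδpos
  refine ⟨N, hNo.mem_nhds hx₀N, fun f hf hfK hb x hx => ?_⟩
  obtain ⟨Φ, hΦ, hΦf⟩ := ((mem_holCotForms₂_iff F E c J hc hfix w₁ 𝔣 f).1 hf).2.2.2 (finAdelicToAdelic F E c 2 J (UnitaryGroup.finPart F E c 2 J x₀))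
  have hΦ1 : ∀ u : archLocal E 2 J w₁, ‖Φ ((u : GL (Fin 2) ℂ) : Matrix (Fin 2) (Fin 2) ℂ)‖ ≤ 1 := fun u => by
    rw [hΦf u]; exact hb _
  have hfx := apply_eq_slice_of_mem 𝔣 hf hfK x₀ hΦf hx.1
  have hfx₀ : f x₀ = Φ (((archAt F E c 2 J w₁ (hfix w₁.1) hc (UnitaryGroup.archPart F E c 2 J x₀) : archLocal E 2 J w₁) : GL (Fin 2) ℂ) :
      Matrix (Fin 2) (Fin 2) ℂ) := by
    refine apply_eq_slice_of_mem 𝔣 hf hfK x₀ hΦf ?_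
    simp only [inv_mul_cancel]
    exact K.one_mem
  have hxR : mat x ∈ ball (mat x₀) R := mem_ball.2 (lt_of_lt_of_le hx.2 (min_le_left _ _))
  have key : ‖Φ (((archAt F E c 2 J w₁ (hfix w₁.1) hc (UnitaryGroup.archPart F E c 2 J x) : archLocal E 2 J w₁) : GL (Fin 2) ℂ) :
        Matrix (Fin 2) (Fin 2) ℂ) -
      Φ (((archAt F E c 2 J w₁ (hfix w₁.1) hc (UnitaryGroup.archPart F E c 2 J x₀) : archLocal E 2 J w₁) : GL (Fin 2) ℂ) :
        Matrix (Fin 2) (Fin 2) ℂ)‖ ≤ L * ‖mat x - mat x₀‖ :=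
    hLip ⟨Φ, hΦ, hΦ1⟩ (mat x) hxR (mat x₀) (mem_ball_self hR)
  rw [hfx, hfx₀]
  calc _ ≤ L * ‖mat x - mat x₀‖ := key
    _ ≤ |L| * ‖mat x - mat x₀‖ := mul_le_mul_of_nonneg_right (le_abs_self L) (norm_nonneg _)
    _ < |L| * δ + δ := by
        have h1 : ‖mat x - mat x₀‖ < δ := by rw [← dist_eq_norm]; exact hx.2
        nlinarith [abs_nonneg L, h1, hδpos, norm_nonneg (mat x - mat x₀)]
    _ = (|L| + 1) * δ := by ring
    _ ≤ (|L| + 1) * (ε / (|L| + 1)) := mul_le_mul_of_nonneg_left (min_le_right _ _) (by positivity)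
    _ = ε := by field_simp

/-! ## §3 Closedness: pointwise limits of bounded sequences of the space (Montel on the cone-open for the slices) -/

/-- **The `w₁`-slices of a pointwise limit are cone-holomorphic (Montel).**  If `f_n ∈ holCotForms₂ 𝔣` with `‖f_n‖_∞ ≤ 1` converge pointwise to
`g`, then at every `x` the slice `u ↦ g (x · adelicSingle w₁ u)` is the restriction of an `IsConeHol` function: the slices `Φ_n` of the `f_n` are
locally uniformly bounded on `Ω` (cotangent modulus), a subsequence converges locally uniformly to a holomorphic `Ψ` (★ MontelSCV), the cone law
and the values on `U(σ_{w₁}J)(ℂ)` pass to the limit, and `Ψ` extended by `0` off `Ω` (forced by the law at `a = 0`) is the required function.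
[cite: HormanderSCV1973, Thm 2.2.7] [cite: Borel1997, §5.13–§5.14] -/
theorem exists_isConeHol_slice_of_tendsto (𝔣 : ConeFrame E J w₁) (hJ : (J.map w₁.1.embedding).IsHermitian)
    {fseq : ℕ → (adelicGroupData F E c 2 J).Adelic → ℂ} {g : (adelicGroupData F E c 2 J).Adelic → ℂ}
    (hf : ∀ n, fseq n ∈ holCotForms₂ F E c J hc hfix w₁ 𝔣) (hb : ∀ n y, ‖fseq n y‖ ≤ 1)
    (hlim : ∀ y, Tendsto (fun n => fseq n y) atTop (𝓝 (g y))) (x : (adelicGroupData F E c 2 J).Adelic) :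
    ∃ Φ : Matrix (Fin 2) (Fin 2) ℂ → ℂ, IsConeHol 𝔣 Φ ∧
      ∀ u : archLocal E 2 J w₁, Φ ((u : GL (Fin 2) ℂ) : Matrix (Fin 2) (Fin 2) ℂ) = g (x * adelicSingle F E c 2 J hc hfix w₁ u) := by
  classical
  -- the slices of the `f_n` at `x`
  have hH : ∀ n, ∃ Φ : Matrix (Fin 2) (Fin 2) ℂ → ℂ, IsConeHol 𝔣 Φ ∧
      ∀ u : archLocal E 2 J w₁, Φ ((u : GL (Fin 2) ℂ) : Matrix (Fin 2) (Fin 2) ℂ) = fseq n (x * adelicSingle F E c 2 J hc hfix w₁ u) :=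
    fun n => ((mem_holCotForms₂_iff F E c J hc hfix w₁ 𝔣 _).1 (hf n)).2.2.2 x
  choose Φ hΦ hΦf using hH
  have hΦ1 : ∀ n (u : archLocal E 2 J w₁), ‖Φ n ((u : GL (Fin 2) ℂ) : Matrix (Fin 2) (Fin 2) ℂ)‖ ≤ 1 := fun n u => by
    rw [hΦf n u]; exact hb n _
  have hΩo := isOpen_coneOpen 𝔣
  have hdiff := differentiableOn_family 𝔣 Φ hΦ
  have hbdd := locallyBounded_family 𝔣 hJ Φ hΦ hΦ1
  -- Montel
  obtain ⟨Ψ, φ, hφ, hΨlim⟩ := Literature.Analysis.Complex.SCV.exists_strictMono_tendstoLocallyUniformlyOn hΩo hdiff hbdd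
  have hΨdiff : DifferentiableOn ℂ Ψ _ := Literature.Analysis.Complex.SCV.differentiableOn_of_tendstoLocallyUniformlyOn hΩo (fun n => hdiff (φ n)) hΨlim
  have hpt : ∀ g : Matrix (Fin 2) (Fin 2) ℂ, IsUnit g → g *ᵥ 𝔣.v₀ ∈ negCone (J.map w₁.1.embedding) →
      Tendsto (fun n => Φ (φ n) g) atTop (𝓝 (Ψ (fun i j => g i j))) := fun g hg hgv =>
    hΨlim.tendsto_at (mem_coneOpen_of_isUnit 𝔣 hg hgv)
  -- the extension by zero off the cone-open
  refine ⟨fun m => if IsUnit m ∧ m *ᵥ 𝔣.v₀ ∈ negCone (J.map w₁.1.embedding) then Ψ (fun i j => m i j) else 0, ⟨?_, ?_⟩, ?_⟩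
  · -- holomorphy on the cone-open
    refine hΨdiff.congr fun m hm => ?_
    have hm' := isUnit_of_mem_coneOpen 𝔣 hm
    show (if IsUnit (Matrix.of m) ∧ Matrix.of m *ᵥ 𝔣.v₀ ∈ negCone (J.map w₁.1.embedding) then Ψ (fun i j => Matrix.of m i j) else 0) = Ψ m
    rw [if_pos hm']
    rfl
  · -- the cone law
    intro g b a k d hg hgv hk hbv hbt
    by_cases ha : a = 0
    · -- `a = 0`: `g b` is not invertible, both sides vanish
      subst ha
      have hnb : ¬ IsUnit b := not_isUnit_of_frame_coords_zero 𝔣 hJ hk hbv hbt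
      have hngb : ¬ (IsUnit (g * b) ∧ (g * b) *ᵥ 𝔣.v₀ ∈ negCone (J.map w₁.1.embedding)) := by
        rintro ⟨hu, -⟩
        have hdet : IsUnit (g * b).det := (Matrix.isUnit_iff_isUnit_det _).1 hu
        rw [Matrix.det_mul] at hdet
        exact hnb ((Matrix.isUnit_iff_isUnit_det _).2 (isUnit_of_mul_isUnit_right hdet))
      simp only [hngb, if_false, zero_mul]
    · have hbu : IsUnit b := isUnit_of_frame_coords 𝔣 hJ hk ha hbv hbt
      have hgbu : IsUnit (g * b) := hg.mul hbu
      have hgbv : (g * b) *ᵥ 𝔣.v₀ ∈ negCone (J.map w₁.1.embedding) := by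
        rw [← mulVec_mulVec, hbv, mulVec_smul]
        exact smul_mem_negCone hk hgv
      have hgb : IsUnit (g * b) ∧ (g * b) *ᵥ 𝔣.v₀ ∈ negCone (J.map w₁.1.embedding) := ⟨hgbu, hgbv⟩
      have hg' : IsUnit g ∧ g *ᵥ 𝔣.v₀ ∈ negCone (J.map w₁.1.embedding) := ⟨hg, hgv⟩
      simp only [hgb, hg', and_self, if_true]
      -- pass the law of the `Φ_n` to the limit
      have h1 := hpt (g * b) hgbu hgbv
      have h2 : Tendsto (fun n => Φ (φ n) (g * b)) atTop (𝓝 ((a * k⁻¹) * Ψ (fun i j => g i j))) := by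
        have h := (hpt g hg hgv).const_mul (a * k⁻¹)
        refine h.congr fun n => ?_
        exact ((hΦ (φ n)).2 g b a k d hg hgv hk hbv hbt).symm
      exact tendsto_nhds_unique h1 h2
  · -- the values on `U(σ_{w₁}J)(ℂ)`
    intro u
    obtain ⟨huu, huv⟩ := isUnit_and_mulVec_mem_negCone 𝔣 u
    have hu' : IsUnit ((u : GL (Fin 2) ℂ) : Matrix (Fin 2) (Fin 2) ℂ) ∧
        ((u : GL (Fin 2) ℂ) : Matrix (Fin 2) (Fin 2) ℂ) *ᵥ 𝔣.v₀ ∈ negCone (J.map w₁.1.embedding) := ⟨huu, huv⟩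
    simp only [hu', and_self, if_true]
    have h1 := hpt _ huu huv
    have h2 : Tendsto (fun n => Φ (φ n) ((u : GL (Fin 2) ℂ) : Matrix (Fin 2) (Fin 2) ℂ)) atTop
        (𝓝 (g (x * adelicSingle F E c 2 J hc hfix w₁ u))) := by
      have h := (hlim (x * adelicSingle F E c 2 J hc hfix w₁ u)).comp hφ.tendsto_atTop
      refine h.congr fun n => ?_
      simp only [Function.comp_apply, hΦf]
    exact tendsto_nhds_unique h1 h2

/-- **Closedness of the sup-unit-ball under pointwise limits**: a pointwise limit of right-`K`-invariant (`K` open) holomorphic cotangent forms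
bounded by `1` is again one. [cite: BorelJacquet1979, §4.2–§4.3] [cite: HormanderSCV1973, Thm 2.2.7] -/
theorem mem_of_tendsto (𝔣 : ConeFrame E J w₁) (hJ : (J.map w₁.1.embedding).IsHermitian) {K : Subgroup (finAdelic F E c 2 J)}
    (hKo : IsOpen (K : Set (finAdelic F E c 2 J)))
    {fseq : ℕ → (adelicGroupData F E c 2 J).Adelic → ℂ} {g : (adelicGroupData F E c 2 J).Adelic → ℂ}
    (hf : ∀ n, fseq n ∈ holCotForms₂ F E c J hc hfix w₁ 𝔣)
    (hK : ∀ n, ∀ k ∈ K, ∀ x : (adelicGroupData F E c 2 J).Adelic, fseq n (x * finAdelicToAdelic F E c 2 J k) = fseq n x)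
    (hb : ∀ n y, ‖fseq n y‖ ≤ 1) (hlim : ∀ y, Tendsto (fun n => fseq n y) atTop (𝓝 (g y))) :
    g ∈ holCotForms₂ F E c J hc hfix w₁ 𝔣 ∧
      (∀ k ∈ K, ∀ x : (adelicGroupData F E c 2 J).Adelic, g (x * finAdelicToAdelic F E c 2 J k) = g x) ∧ ∀ y, ‖g y‖ ≤ 1 := by
  -- limits of equal sequences are equal
  have hlimeq : ∀ y y' : (adelicGroupData F E c 2 J).Adelic, (∀ n, fseq n y = fseq n y') → g y = g y' := fun y y' h =>
    tendsto_nhds_unique (hlim y) (by simpa only [h] using hlim y')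
  have hgK : ∀ k ∈ K, ∀ x : (adelicGroupData F E c 2 J).Adelic, g (x * finAdelicToAdelic F E c 2 J k) = g x :=
    fun k hk x => hlimeq _ _ fun n => hK n k hk x
  refine ⟨(mem_holCotForms₂_iff F E c J hc hfix w₁ 𝔣 g).2 ⟨?_, ?_, ?_, ?_⟩, hgK, fun y => ?_⟩
  · intro γ x
    exact hlimeq _ _ fun n => ((mem_holCotForms₂_iff F E c J hc hfix w₁ 𝔣 _).1 (hf n)).1 γ x
  · intro k hk x
    exact hlimeq _ _ fun n => ((mem_holCotForms₂_iff F E c J hc hfix w₁ 𝔣 _).1 (hf n)).2.1 k hk x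
  · exact (mem_smoothFun₂_iff F E c J g).2 ⟨K, hKo, hgK⟩
  · exact exists_isConeHol_slice_of_tendsto 𝔣 hJ hf hb hlim
  · exact le_of_tendsto (hlim y).norm (Eventually.of_forall fun n => hb n y)

end UnitaryCurveForms

end Literature.NumberTheory.Automorphic

end
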